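import Mathlib.Algebra.BigOperators.Finprod
import Mathlib.Algebra.Order.BigOperators.Group.Finset
import Mathlib.Data.Set.Card.Arithmetic
import Mathlib.GroupTheory.Index
import Mathlib.GroupTheory.GroupAction.Quotient
import Mathlib.GroupTheory.GroupAction.Basic
import Mathlib.Tactic.Group

/-!
# Cosets over an orbit: `#{Γg : g·x ∈ Γ·y} = [Stab(y) : Stab(y) ∩ Γ]`, and the mass formula
# `#(Γ \ {g : g·x ∈ Y}) = Σ_{Γ·y ⊆ G·x ∩ Y} [Stab(y) : Stab(y) ∩ Γ]`

Topic `Literature/GroupTheory/Index`; Mathlib-only, everything proved.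

Let a group `G` act on a set `X`, let `Γ ≤ G` be a subgroup, `x ∈ X`, and let `Y ⊆ X` be a
`Γ`-stable subset. Two ways of "counting the `Γ`-integral structures on the `G`-orbit of `x`" are
compared:

* the number of cosets `Γg` of elements `g ∈ G` with `g · x ∈ Y` (`cosetsOver Γ x Y`, realised in
  Mathlib's `G ⧸ Γ` as the left cosets `g⁻¹Γ`);
* the sum, over the `Γ`-orbits `Γ·y` contained in `G·x ∩ Y`, of the indices
  `[Stab_G(y) : Stab_G(y) ∩ Γ] = #Stab_G(y) / #Stab_Γ(y)`.

**Theorem** (`ncard_cosetsOver_orbit`, `ncard_cosetsOver_eq_finsum_relIndex`). For `y = g₀ · x` the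
cosets `Γg` with `g · x ∈ Γ · y` number exactly `[Stab_G(y) : Stab_G(y) ∩ Γ]` (they form one orbit
of `Stab_G(x)` on `G ⧸ Γ`, with stabiliser `Stab_G(x) ∩ g₀⁻¹Γg₀ ≅ Stab_G(y) ∩ Γ`); hence, for any set
of representatives `r(O) ∈ O` of the `Γ`-orbits `O ⊆ G·x ∩ Y`,

  `#(cosetsOver Γ x Y) = Σ_O [Stab_G(r O) : Stab_G(r O) ∩ Γ]`

whenever the left side is finite; in particular `#(cosetsOver Γ x Y) ≥ #{Γ-orbits in G·x ∩ Y}`,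
with equality iff every `y ∈ G·x ∩ Y` has `Stab_G(y) ≤ Γ` (`ncard_orbitsIn_le_ncard_cosetsOver`,
`ncard_cosetsOver_eq_ncard_orbitsIn_iff`); and all of this depends only on the `G`-orbit of `x`
(`cosetsOver_smul_eq_image`, `ncard_cosetsOver_smul`, `orbitsIn_smul`).

This is the group theory behind the weights
`m(f) = Σ_{f' ∈ B(f)} #Aut_ℚ(f')/#Aut_ℤ(f')` of Bhargava–Shankar (*Binary quartic forms having
bounded invariants…*, Ann. of Math. 181 (2015), §3.2 and Prop. 3.6 of the published version), where
`G = PGL₂(ℚ)` acts on binary quartic forms, `Γ = PGL₂(ℤ)`, `Y = V_ℤ`: it identifies `m(f)` with the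
number of cosets `PGL₂(ℤ)g` (`g ∈ PGL₂(ℚ)`) with `g · f ∈ V_ℤ`, the form in which `m(f) = ∏_p m_p(f)`
becomes "`PGL₂` has class number one" (companion files under `Literature/NumberTheory/EllipticCurves`).

## References

* Standard (orbit–stabiliser for the action of `Stab_G(x)` on `G ⧸ Γ`; double cosets
  `Γ \ G / Stab_G(x)`). [folklore]
* M. Bhargava, A. Shankar, Ann. of Math. (2) 181 (2015) 191–242, §3.2, Prop. 3.6 (use).

## Design

Cosets `Γg` are encoded as the elements `↑(g⁻¹)` of Mathlib's left coset space `G ⧸ Γ` (so that the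
available `MulAction G (G ⧸ Γ)` can be used); `mem_cosetsOver_iff` is the dictionary. Indices are
Mathlib's `Subgroup.relIndex Γ (stabilizer G y) = [Stab_G(y) : Stab_G(y) ∩ Γ]`, with the convention
`0` for an infinite index, matching `Set.ncard = 0` for infinite sets: the per-orbit identity holds
unconditionally, the sum formula under finiteness of the coset set.
-/

namespace Literature.GroupTheory.Index

open MulAction
open scoped Pointwise

variable {G : Type*} [Group G] {X : Type*} [MulAction G X]

/-- The set of cosets `Γg` of the elements `g ∈ G` carrying `x` into `Y`, realised in `G ⧸ Γ` as the
left cosets `g⁻¹Γ` (for `Γ`-stable `Y` the condition `g · x ∈ Y` depends only on `Γg`,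
`mem_cosetsOver_iff`). [folklore] -/
def cosetsOver (Γ : Subgroup G) (x : X) (Y : Set X) : Set (G ⧸ Γ) :=
  {q | ∃ g : G, ((g⁻¹ : G) : G ⧸ Γ) = q ∧ g • x ∈ Y}

variable (Γ : Subgroup G) (x : X)

/-- A set `Y ⊆ X` is `Γ`-stable if `γ · Y ⊆ Y` for all `γ ∈ Γ` (then `γ · Y = Y`). [folklore] -/
def IsStableUnder (Y : Set X) : Prop := ∀ γ ∈ Γ, ∀ y ∈ Y, γ • y ∈ Y

variable {Γ x}

/-- Unfolding of `cosetsOver`. [folklore] -/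
theorem mem_cosetsOver {Y : Set X} {q : G ⧸ Γ} :
    q ∈ cosetsOver Γ x Y ↔ ∃ g : G, ((g⁻¹ : G) : G ⧸ Γ) = q ∧ g • x ∈ Y := Iff.rfl

/-- `Γg ∈ cosetsOver Γ x Y` for `g · x ∈ Y`. [folklore] -/
theorem inv_mem_cosetsOver {Y : Set X} {g : G} (hg : g • x ∈ Y) :
    ((g⁻¹ : G) : G ⧸ Γ) ∈ cosetsOver Γ x Y := ⟨g, rfl, hg⟩

/-- An orbit of `Γ` is `Γ`-stable. [folklore] -/
theorem isStableUnder_orbit (y : X) : IsStableUnder Γ (orbit Γ y) := by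
  rintro γ hγ _ ⟨δ, rfl⟩
  exact ⟨⟨γ, hγ⟩ * δ, by simp [mul_smul, Subgroup.smul_def]⟩

/-- A `Γ`-stable set is a union of `Γ`-orbits. [folklore] -/
theorem IsStableUnder.orbit_subset {Y : Set X} (hY : IsStableUnder Γ Y) {y : X} (hy : y ∈ Y) :
    orbit Γ y ⊆ Y := by
  rintro _ ⟨γ, rfl⟩
  exact hY γ γ.2 y hy

/-- The dictionary: for `Γ`-stable `Y`, the coset `hΓ ∈ G ⧸ Γ` belongs to `cosetsOver Γ x Y` iff
`h⁻¹ · x ∈ Y` (i.e. iff `g · x ∈ Y` for one, or every, `g ∈ Γh⁻¹`). [folklore] -/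
theorem mem_cosetsOver_iff {Y : Set X} (hY : IsStableUnder Γ Y) (h : G) :
    (h : G ⧸ Γ) ∈ cosetsOver Γ x Y ↔ h⁻¹ • x ∈ Y := by
  constructor
  · rintro ⟨g, hgq, hg⟩
    have hmem : g * h ∈ Γ := by
      have := QuotientGroup.eq.mp hgq
      simpa using this
    have : h⁻¹ • x = (g * h)⁻¹ • g • x := by
      rw [smul_smul, mul_inv_rev, mul_assoc, inv_mul_cancel, mul_one]
    rw [this]
    exact hY _ (Γ.inv_mem hmem) _ hg
  · intro hh
    exact ⟨h⁻¹, by rw [inv_inv], hh⟩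

/-- `cosetsOver` is monotone in `Y`. [folklore] -/
theorem cosetsOver_mono {Y Y' : Set X} (h : Y ⊆ Y') : cosetsOver Γ x Y ⊆ cosetsOver Γ x Y' := by
  rintro q ⟨g, rfl, hg⟩
  exact ⟨g, rfl, h hg⟩

/-- Only the part of `Y` inside the orbit `G · x` matters. [folklore] -/
theorem cosetsOver_inter_orbit (Y : Set X) : cosetsOver Γ x (orbit G x ∩ Y) = cosetsOver Γ x Y := by
  refine Set.Subset.antisymm (cosetsOver_mono Set.inter_subset_right) ?_
  rintro q ⟨g, rfl, hg⟩
  exact ⟨g, rfl, ⟨mem_orbit x g, hg⟩⟩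

/-! ## The cosets over one `Γ`-orbit -/

/-- A subgroup `S ≤ G` acts on `G ⧸ Γ` through `G`: `s • gΓ = (s g)Γ`. [folklore] -/
theorem subgroup_smul_coe (S : Subgroup G) (s : S) (g : G) :
    (s • (g : G ⧸ Γ) : G ⧸ Γ) = (((s : G) * g : G) : G ⧸ Γ) := rfl

/-- The cosets over the `Γ`-orbit of `y = g₀ · x` form the orbit of the point `g₀⁻¹Γ ∈ G ⧸ Γ` under
`Stab_G(x)` (acting on `G ⧸ Γ` by left multiplication). [folklore] -/
theorem cosetsOver_orbit_eq_orbit_stabilizer (g₀ : G) :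
    cosetsOver Γ x (orbit Γ (g₀ • x)) = orbit (stabilizer G x) ((g₀⁻¹ : G) : G ⧸ Γ) := by
  ext q
  induction q using QuotientGroup.induction_on with
  | H h =>
  rw [mem_cosetsOver_iff (isStableUnder_orbit _), mem_orbit_iff, mem_orbit_iff]
  constructor
  · rintro ⟨γ, hγ⟩
    -- `γ g₀ x = h⁻¹ x`, so `s = h γ g₀ ∈ Stab(x)` and `s • g₀⁻¹Γ = h γ Γ = hΓ`
    have hγ' : (γ : G) • g₀ • x = h⁻¹ • x := hγ
    refine ⟨⟨h * γ * g₀, ?_⟩, ?_⟩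
    · rw [mem_stabilizer_iff, mul_smul, mul_smul, hγ', smul_inv_smul]
    · rw [subgroup_smul_coe, Subgroup.coe_mk, QuotientGroup.eq]
      simp [mul_assoc]
  · rintro ⟨s, hs⟩
    rw [subgroup_smul_coe, QuotientGroup.eq] at hs
    -- `(s g₀⁻¹)⁻¹ h = g₀ s⁻¹ h ∈ Γ`; put `γ = (g₀ s⁻¹ h)⁻¹`
    refine ⟨⟨(((s : G) * g₀⁻¹)⁻¹ * h)⁻¹, Γ.inv_mem hs⟩, ?_⟩
    rw [Subgroup.smul_def, Subgroup.coe_mk, smul_smul]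
    have : (((s : G) * g₀⁻¹)⁻¹ * h)⁻¹ * g₀ = h⁻¹ * s := by group
    rw [this, mul_smul, mem_stabilizer_iff.mp s.2]

/-- The stabiliser of the point `g₀⁻¹Γ ∈ G ⧸ Γ` in `Stab_G(x)` is `Stab_G(x) ∩ g₀⁻¹Γg₀`. [folklore] -/
theorem stabilizer_stabilizer_coe_inv (g₀ : G) :
    stabilizer (stabilizer G x) ((g₀⁻¹ : G) : G ⧸ Γ) =
      (Γ.comap (MulAut.conj g₀).toMonoidHom).subgroupOf (stabilizer G x) := by
  ext s
  rw [mem_stabilizer_iff, Subgroup.mem_subgroupOf, Subgroup.mem_comap, subgroup_smul_coe,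
    QuotientGroup.eq]
  simp only [mul_inv_rev, inv_inv, MulEquiv.coe_toMonoidHom, MulAut.conj_apply]
  -- `g₀ s⁻¹ g₀⁻¹ ∈ Γ ↔ g₀ s g₀⁻¹ ∈ Γ`
  constructor <;> intro h
  · have := Γ.inv_mem h
    simpa [mul_assoc] using this
  · have := Γ.inv_mem h
    simpa [mul_assoc] using this

/-- **The number of cosets `Γg` with `g · x ∈ Γ · y` is `[Stab_G(y) : Stab_G(y) ∩ Γ]`** for `y` in
the `G`-orbit of `x` (both sides `0` when infinite). [folklore] -/
theorem ncard_cosetsOver_orbit {y : X} (hy : y ∈ orbit G x) :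
    (cosetsOver Γ x (orbit Γ y)).ncard = Γ.relIndex (stabilizer G y) := by
  obtain ⟨g₀, rfl⟩ := hy
  rw [cosetsOver_orbit_eq_orbit_stabilizer, ← index_stabilizer, stabilizer_stabilizer_coe_inv,
    ← Subgroup.relIndex, stabilizer_smul_eq_stabilizer_map_conj]
  set φ : G →* G := (MulAut.conj g₀).toMonoidHom with hφ
  have hinj : Function.Injective φ := (MulAut.conj g₀).injective
  have hsurj : Function.Surjective φ := (MulAut.conj g₀).surjective
  rw [← Subgroup.relIndex_map_map_of_injective (f := φ) _ _ hinj,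
    Subgroup.map_comap_eq_self_of_surjective hsurj]

/-- The index `[Stab_G(y) : Stab_G(y) ∩ Γ]` is constant along `Γ`-orbits. [folklore] -/
theorem relIndex_stabilizer_smul_of_mem {γ : G} (hγ : γ ∈ Γ) (y : X) :
    Γ.relIndex (stabilizer G (γ • y)) = Γ.relIndex (stabilizer G y) := by
  rw [stabilizer_smul_eq_stabilizer_map_conj]
  set φ : G →* G := (MulAut.conj γ).toMonoidHom
  have hinj : Function.Injective φ := (MulAut.conj γ).injective
  have hΓ : Γ.map φ = Γ := by
    ext g
    constructor
    · rintro ⟨g', hg', rfl⟩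
      exact Γ.mul_mem (Γ.mul_mem hγ hg') (Γ.inv_mem hγ)
    · intro hg
      refine ⟨γ⁻¹ * g * γ, Γ.mul_mem (Γ.mul_mem (Γ.inv_mem hγ) hg) hγ, ?_⟩
      simp [φ, mul_assoc]
  conv_rhs => rw [← Subgroup.relIndex_map_map_of_injective (f := φ) _ _ hinj, hΓ]

/-! ## The mass formula -/

variable (Γ x) in
/-- The `Γ`-orbits contained in `G · x ∩ Y` (for `Γ`-stable `Y`: the orbits of the points of
`G · x ∩ Y`). [folklore] -/
def orbitsIn (Y : Set X) : Set (Set X) := (fun y ↦ (orbit Γ y : Set X)) '' (orbit G x ∩ Y)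

/-- Unfolding of `orbitsIn`. [folklore] -/
theorem mem_orbitsIn {Y : Set X} {O : Set X} :
    O ∈ orbitsIn Γ x Y ↔ ∃ y, (y ∈ orbit G x ∧ y ∈ Y) ∧ orbit Γ y = O := Iff.rfl

/-- For `Γ`-stable `Y`, the cosets over `Y` are the disjoint union of the cosets over the `Γ`-orbits
in `G · x ∩ Y`: every coset lies over exactly one orbit. [folklore] -/
theorem existsUnique_mem_orbitsIn_of_mem_cosetsOver {Y : Set X} {q : G ⧸ Γ}
    (hq : q ∈ cosetsOver Γ x Y) : ∃! O, O ∈ orbitsIn Γ x Y ∧ q ∈ cosetsOver Γ x O := by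
  obtain ⟨g, rfl, hg⟩ := hq
  refine ⟨orbit Γ (g • x), ⟨⟨g • x, ⟨mem_orbit x g, hg⟩, rfl⟩, g, rfl, mem_orbit_self _⟩, ?_⟩
  rintro O ⟨⟨y, -, rfl⟩, g', hg'q, hg'⟩
  -- `g' x ∈ Γ y` and `Γ g' = Γ g`, so `Γ y = Γ (g' x) = Γ (g x)`
  have hmem : g' * g⁻¹ ∈ Γ := by
    have := QuotientGroup.eq.mp hg'q
    simpa using this
  have h1 : orbit Γ y = orbit Γ (g' • x) := (orbit_eq_iff.mpr hg').symm
  have h2 : g' • x = (⟨g' * g⁻¹, hmem⟩ : Γ) • g • x := by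
    rw [Subgroup.smul_def, Subgroup.coe_mk, smul_smul, inv_mul_cancel_right]
  show orbit Γ y = orbit Γ (g • x)
  rw [h1, h2, orbit_smul]

/-- Cosets over a `Γ`-orbit inside `Y` are cosets over `Y`. [folklore] -/
theorem cosetsOver_subset_of_mem_orbitsIn {Y : Set X} (hY : IsStableUnder Γ Y) {O : Set X}
    (hO : O ∈ orbitsIn Γ x Y) : cosetsOver Γ x O ⊆ cosetsOver Γ x Y := by
  obtain ⟨y, ⟨-, hy⟩, rfl⟩ := hO
  exact cosetsOver_mono (hY.orbit_subset hy)

/-- The coset set over `Y` is in bijection with the disjoint union, over the `Γ`-orbits `O` in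
`G · x ∩ Y`, of the coset sets over `O`. [folklore] -/
noncomputable def cosetsOverEquivSigma {Y : Set X} (hY : IsStableUnder Γ Y) :
    cosetsOver Γ x Y ≃ Σ O : orbitsIn Γ x Y, cosetsOver Γ x (O : Set X) where
  toFun q := ⟨⟨(existsUnique_mem_orbitsIn_of_mem_cosetsOver q.2).choose,
      (existsUnique_mem_orbitsIn_of_mem_cosetsOver q.2).choose_spec.1.1⟩,
    ⟨q, (existsUnique_mem_orbitsIn_of_mem_cosetsOver q.2).choose_spec.1.2⟩⟩
  invFun s := ⟨s.2, cosetsOver_subset_of_mem_orbitsIn hY s.1.2 s.2.2⟩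
  left_inv q := rfl
  right_inv := by
    rintro ⟨⟨O, hO⟩, q, hq⟩
    have hu := existsUnique_mem_orbitsIn_of_mem_cosetsOver (cosetsOver_subset_of_mem_orbitsIn hY hO hq)
    have hO' : hu.choose = O := hu.unique hu.choose_spec.1 ⟨hO, hq⟩
    exact Sigma.subtype_ext (Subtype.ext hO') rfl

/-- If the cosets over `Y` are finitely many, so are the `Γ`-orbits in `G · x ∩ Y`. [folklore] -/
theorem finite_orbitsIn_of_finite {Y : Set X} (hfin : (cosetsOver Γ x Y).Finite) :
    (orbitsIn Γ x Y).Finite := by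
  -- each orbit `Γ y`, `y = g x ∈ Y`, carries the coset `Γ g`; distinct orbits carry distinct cosets
  have : orbitsIn Γ x Y ⊆ (fun q : G ⧸ Γ ↦ (orbit Γ (q.out⁻¹ • x) : Set X)) '' cosetsOver Γ x Y := by
    rintro O ⟨y, ⟨⟨g, rfl⟩, hy⟩, rfl⟩
    refine ⟨((g⁻¹ : G) : G ⧸ Γ), inv_mem_cosetsOver hy, ?_⟩
    have hmem : (g⁻¹)⁻¹ * ((g⁻¹ : G) : G ⧸ Γ).out ∈ Γ := QuotientGroup.eq.mp (by simp)
    rw [inv_inv] at hmem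
    have : ((g⁻¹ : G) : G ⧸ Γ).out⁻¹ • x = (⟨(g * ((g⁻¹ : G) : G ⧸ Γ).out)⁻¹, Γ.inv_mem hmem⟩ : Γ) • g • x := by
      rw [Subgroup.smul_def, Subgroup.coe_mk, smul_smul, mul_inv_rev, inv_mul_cancel_right]
    simp only [this, orbit_smul]
  exact (hfin.image _).subset this

/-- Over a `Γ`-orbit in `G · x ∩ Y` there is at least one coset; so if the cosets over `Y` are
finitely many, `1 ≤ [Stab_G(y) : Stab_G(y) ∩ Γ]` for every `y ∈ G · x ∩ Y`. [folklore] -/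
theorem one_le_relIndex_stabilizer {Y : Set X} (hY : IsStableUnder Γ Y) (hfin : (cosetsOver Γ x Y).Finite)
    {y : X} (hyx : y ∈ orbit G x) (hyY : y ∈ Y) : 1 ≤ Γ.relIndex (stabilizer G y) := by
  have hO : (orbit Γ y : Set X) ∈ orbitsIn Γ x Y := ⟨y, ⟨hyx, hyY⟩, rfl⟩
  have hfinO : (cosetsOver Γ x (orbit Γ y)).Finite :=
    hfin.subset (cosetsOver_subset_of_mem_orbitsIn hY hO)
  rw [← ncard_cosetsOver_orbit hyx, Nat.one_le_iff_ne_zero, Ne, Set.ncard_eq_zero hfinO]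
  obtain ⟨g, rfl⟩ := hyx
  exact Set.nonempty_iff_ne_empty.mp ⟨_, inv_mem_cosetsOver (x := x) (mem_orbit_self (g • x))⟩

/-- The index attached to an orbit does not depend on the representative. [folklore] -/
theorem relIndex_stabilizer_eq_of_mem_orbitsIn {O : Set X} {y z : X}
    (hO : orbit Γ y = O) (hz : z ∈ O) :
    Γ.relIndex (stabilizer G z) = Γ.relIndex (stabilizer G y) := by
  subst hO
  obtain ⟨γ, rfl⟩ := mem_orbit_iff.mp hz
  rw [Subgroup.smul_def, relIndex_stabilizer_smul_of_mem γ.2]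

/-- **Mass formula.** For `Γ`-stable `Y` and any representatives `r O ∈ O` of the `Γ`-orbits `O` in
`G · x ∩ Y`: if the cosets `Γg` with `g · x ∈ Y` are finitely many, their number is
`Σ_O [Stab_G(r O) : Stab_G(r O) ∩ Γ]`. [folklore] -/
theorem ncard_cosetsOver_eq_finsum_relIndex {Y : Set X} (hY : IsStableUnder Γ Y)
    (hfin : (cosetsOver Γ x Y).Finite) {r : Set X → X} (hr : ∀ O ∈ orbitsIn Γ x Y, r O ∈ O) :
    (cosetsOver Γ x Y).ncard = ∑ᶠ O ∈ orbitsIn Γ x Y, Γ.relIndex (stabilizer G (r O)) := by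
  have hOfin := finite_orbitsIn_of_finite hfin
  haveI : Fintype (orbitsIn Γ x Y) := hOfin.fintype
  haveI : ∀ O : orbitsIn Γ x Y, Finite (cosetsOver Γ x (O : Set X)) := fun O ↦
    (hfin.subset (cosetsOver_subset_of_mem_orbitsIn hY O.2)).to_subtype
  have h2 : ∀ O : orbitsIn Γ x Y,
      Nat.card (cosetsOver Γ x (O : Set X)) = Γ.relIndex (stabilizer G (r O)) := by
    rintro ⟨O, hO⟩
    obtain ⟨y, ⟨hyx, hyY⟩, rfl⟩ := hO
    rw [Nat.card_coe_set_eq, relIndex_stabilizer_eq_of_mem_orbitsIn rfl (hr _ ⟨y, ⟨hyx, hyY⟩, rfl⟩)]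
    exact ncard_cosetsOver_orbit hyx
  rw [← Nat.card_coe_set_eq, Nat.card_congr (cosetsOverEquivSigma hY), Nat.card_sigma,
    ← finsum_set_coe_eq_finsum_mem, finsum_eq_sum_of_fintype]
  exact Finset.sum_congr rfl fun O _ ↦ h2 O

/-- There are at least as many cosets `Γg` with `g · x ∈ Y` as `Γ`-orbits in `G · x ∩ Y` (when the
former are finitely many). [folklore] -/
theorem ncard_orbitsIn_le_ncard_cosetsOver {Y : Set X} (hY : IsStableUnder Γ Y)
    (hfin : (cosetsOver Γ x Y).Finite) : (orbitsIn Γ x Y).ncard ≤ (cosetsOver Γ x Y).ncard := by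
  classical
  obtain ⟨r, hr⟩ : ∃ r : Set X → X, ∀ O ∈ orbitsIn Γ x Y, r O ∈ O := by
    refine ⟨fun O ↦ if h : O.Nonempty then h.some else x, fun O hO ↦ ?_⟩
    obtain ⟨y, -, rfl⟩ := hO
    have h : (orbit Γ y : Set X).Nonempty := ⟨y, mem_orbit_self y⟩
    show (if h : (orbit Γ y : Set X).Nonempty then h.some else x) ∈ orbit Γ y
    rw [dif_pos h]; exact h.some_mem
  have hOfin := finite_orbitsIn_of_finite hfin
  rw [ncard_cosetsOver_eq_finsum_relIndex hY hfin hr, ← finsum_one,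
    finsum_mem_eq_finite_toFinset_sum _ hOfin, finsum_mem_eq_finite_toFinset_sum _ hOfin]
  refine Finset.sum_le_sum fun O hO ↦ ?_
  rw [Set.Finite.mem_toFinset] at hO
  obtain ⟨y, ⟨hyx, hyY⟩, rfl⟩ := id hO
  rw [relIndex_stabilizer_eq_of_mem_orbitsIn rfl (hr _ hO)]
  exact one_le_relIndex_stabilizer hY hfin hyx hyY

/-- The two counts agree iff every point of `G · x ∩ Y` has its stabiliser inside `Γ`
(`[Stab_G(y) : Stab_G(y) ∩ Γ] = 1`), the cosets being finitely many. [folklore] -/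
theorem ncard_cosetsOver_eq_ncard_orbitsIn_iff {Y : Set X} (hY : IsStableUnder Γ Y)
    (hfin : (cosetsOver Γ x Y).Finite) :
    (cosetsOver Γ x Y).ncard = (orbitsIn Γ x Y).ncard ↔
      ∀ y ∈ orbit G x ∩ Y, stabilizer G y ≤ Γ := by
  classical
  obtain ⟨r, hr⟩ : ∃ r : Set X → X, ∀ O ∈ orbitsIn Γ x Y, r O ∈ O := by
    refine ⟨fun O ↦ if h : O.Nonempty then h.some else x, fun O hO ↦ ?_⟩
    obtain ⟨y, -, rfl⟩ := hO
    have h : (orbit Γ y : Set X).Nonempty := ⟨y, mem_orbit_self y⟩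
    show (if h : (orbit Γ y : Set X).Nonempty then h.some else x) ∈ orbit Γ y
    rw [dif_pos h]; exact h.some_mem
  have hOfin := finite_orbitsIn_of_finite hfin
  rw [ncard_cosetsOver_eq_finsum_relIndex hY hfin hr, ← finsum_one,
    finsum_mem_eq_finite_toFinset_sum _ hOfin, finsum_mem_eq_finite_toFinset_sum _ hOfin, eq_comm,
    Finset.sum_eq_sum_iff_of_le]
  · constructor
    · rintro h y ⟨hyx, hyY⟩
      have hO : (orbit Γ y : Set X) ∈ orbitsIn Γ x Y := ⟨y, ⟨hyx, hyY⟩, rfl⟩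
      have := h _ (by rwa [Set.Finite.mem_toFinset])
      rw [relIndex_stabilizer_eq_of_mem_orbitsIn rfl (hr _ hO), eq_comm, Subgroup.relIndex_eq_one] at this
      exact this
    · intro h O hO
      rw [Set.Finite.mem_toFinset] at hO
      obtain ⟨y, ⟨hyx, hyY⟩, rfl⟩ := id hO
      rw [relIndex_stabilizer_eq_of_mem_orbitsIn rfl (hr _ hO), eq_comm, Subgroup.relIndex_eq_one]
      exact h y ⟨hyx, hyY⟩
  · intro O hO
    rw [Set.Finite.mem_toFinset] at hO
    obtain ⟨y, ⟨hyx, hyY⟩, rfl⟩ := id hO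
    rw [relIndex_stabilizer_eq_of_mem_orbitsIn rfl (hr _ hO)]
    exact one_le_relIndex_stabilizer hY hfin hyx hyY

/-! ## Translation: the coset count depends only on the `G`-orbit of `x` -/

/-- Translating the base point translates the cosets: `cosetsOver Γ (g · x) Y = g · cosetsOver Γ x Y`
(`G` acting on `G ⧸ Γ`). [folklore] -/
theorem cosetsOver_smul_eq_image (g : G) (Y : Set X) :
    cosetsOver Γ (g • x) Y = (fun q : G ⧸ Γ ↦ g • q) '' cosetsOver Γ x Y := by
  ext q
  induction q using QuotientGroup.induction_on with
  | H h =>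
  constructor
  · rintro ⟨k, hkq, hk⟩
    -- `Γ k⁻¹ = Γ h`-ish: `q = ↑k⁻¹`, and `k g` carries `x` into `Y`
    refine ⟨((k * g)⁻¹ : G), ⟨k * g, rfl, by rwa [mul_smul]⟩, ?_⟩
    show g • (((k * g)⁻¹ : G) : G ⧸ Γ) = _
    rw [← hkq, Quotient.smul_coe, smul_eq_mul, mul_inv_rev, mul_inv_cancel_left]
  · rintro ⟨q', ⟨k, rfl, hk⟩, hq⟩
    refine ⟨k * g⁻¹, ?_, by rwa [mul_smul, inv_smul_smul]⟩
    change g • ((k⁻¹ : G) : G ⧸ Γ) = _ at hq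
    rw [← hq, Quotient.smul_coe, smul_eq_mul, mul_inv_rev, inv_inv]

/-- Hence the number of cosets over `Y` is the same for `x` and `g · x`. [folklore] -/
theorem ncard_cosetsOver_smul (g : G) (Y : Set X) :
    (cosetsOver Γ (g • x) Y).ncard = (cosetsOver Γ x Y).ncard := by
  rw [cosetsOver_smul_eq_image]
  exact Set.ncard_image_of_injective _ (MulAction.injective g)

/-- And finiteness of the coset set is a property of the `G`-orbit of `x`. [folklore] -/
theorem cosetsOver_smul_finite_iff (g : G) (Y : Set X) :
    (cosetsOver Γ (g • x) Y).Finite ↔ (cosetsOver Γ x Y).Finite := by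
  rw [cosetsOver_smul_eq_image]
  exact Set.finite_image_iff (MulAction.injective g).injOn

/-- The `Γ`-orbits in `G · x ∩ Y` only depend on the `G`-orbit of `x`. [folklore] -/
theorem orbitsIn_smul (g : G) (Y : Set X) : orbitsIn Γ (g • x) Y = orbitsIn Γ x Y := by
  rw [orbitsIn, orbitsIn, orbit_smul]

end Literature.GroupTheory.Index
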